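import Mathlib
import Literature.NumberTheory.Sieve.BatemanHorn
import Literature.NumberTheory.Sieve.GrimmeltMerikoski2025Restricted
import HarnessLib

/-!
# The cube-corner ternary divisor problem along `ℓ² + 1` — DEFINITIONS and statement shapes

DEFINITIONS ONLY (counting functions, their local-density models, and `Prop`-valued statement SHAPES
with every threshold/exponent/constant a parameter — nothing is asserted), plus the elementary
bookkeeping between the shapes, PROVED. This is the statement layer over which the rung route
`IllusoryCubeCorner` of the summit `Parity` (sub-problem `BatemanHorn`; ideation cell `parity-ideate`,
planner seat p1, 2026-08-25) states its items as closed instances; the OPEN statements themselves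
(the cell's "K1c / K1c-tw / K1c-log / K1⁺" and the conditional Landau statement) are obligations of our
theories and live in that route file under `Summits/`, not here.

The printed problem. For the sequence `ℓ² + 1` the arithmetic information available to a sieve is
"Type I" (level of distribution of the roots of `ν² + 1 ≡ 0 (mod k)`, Duke–Friedlander–Iwaniec 1995;
de la Bretèche–Drappeau 2020; Grimmelt–Merikoski 2025, Theorem 1.4 = the tree's
`Literature.NumberTheory.Sieve.grimmeltMerikoski2025_thm14_restricted`, level `k ≤ D·X^{1+δ}`,
`d ≤ D ≤ X^{1/2}`) and a narrow "Type II" range. J. Merikoski, *On the largest prime factor of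
`n² + 1`*, JEMS 25 (2023) = arXiv:1908.08816, §4 "Remarks on the arithmetic information": "for large
`P` one should attempt to obtain some other type of arithmetic information … Type I₂ information,
that is, estimates for sums `Σ_{d₁∼D₁, d₂∼D₂} α(d₁d₂)|A_{d₁d₂}|` … the balanced case `D₁ = D₂`
appears to be a difficult problem" [Merikoski2022, §4]. The TRILINEAR ("cube corner") version —
asymptotics for `#{(ℓ, e, f) : efg = ℓ² + 1, e ∼ E, f ∼ F, g ∼ G}` when all three factors exceed
`X^{1/2}`, so that the modulus `ef ∈ [X, X^{3/2}]` is beyond the length `X` — is the divisor-type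
input (`Λ_∞ ≈ τ₃`, Iwaniec, *Conversations on the exceptional character*, §8 (8.14)) that a
Friedlander–Iwaniec "illusory sieve" for `n² + 1` would consume; no instance of it is in print (every
printed method stops at the Parseval term `E·X^{1/2}` of the spectral large sieve, i.e. at
`E ≤ X^{1/2−η}` [GrimmeltMerikoski2025, §5]).

Contents.
* `cornerCount X q a E F G` / `cornerModel …` — the localised trilinear count with one congruence twist
  `e ≡ a (mod q)` and its model (local density `ρ(ef)/(ef)`, `ρ = polyRootCountMod ![X²+1]`);
* `twistedRootCount`, `cornerCountTw`, `cornerModelTw` — the fully twisted, sub-dyadic versions (classes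
  of `ℓ, e, f` and of the cofactor `g` mod `q`), the form a sieve assembly consumes;
* statement SHAPES: `CubeCornerBoundWith θ δ C X₀` (power saving `C·X^{1−δ}`, thresholds `X^θ`, one
  twist), `CubeCornerTwBoundWith θ δ C X₀` (all twists, sub-dyadic), `CubeCornerTwLogBoundWith θ δ A C X₀`
  (log-power saving `C·X·(log X)^{−A}`); `typeISumAP` / `GM25TypeIResidueClassesWith ε δ J X₀`
  (Grimmelt–Merikoski's Type-I form `GM2025.typeISum 1 1` with the smooth modulus additionally in a
  residue class `k ≡ k₀ (mod D₀)`, `D₀ ≤ X^δ`, same bound);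
* PROVED definitional identities: `cornerCount_eq_sum_tw` / `cornerModel_eq_sum_tw` (the one-twist
  dyadic objects are the sums of the fully twisted ones over the `q³` classes `(t, b, r) mod q`, the
  model side through `∑_{t,r} twistedRootCount q t r k = q·ρ(k)`, `sum_sum_twistedRootCount_eq`, and the
  periodicity of the roots, `card_filter_range_mul`); `typeISumAP k₀ 1 = GM2025.typeISum 1 1` and the
  `D₀ = 1` case of the residue-class shape from the tree's `grimmeltMerikoski2025_thm14_restricted_one`
  (`gm25TypeIResidueClassesWith_one`, conditional on that named fact as its source theorem is);
  kernel-evaluated sanity values of `twistedRootCount`. The IMPLICATIONS between closed instances of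
  the shapes (threshold monotonicity; all twists ⇒ one twist with `δ ↦ δ/4`; power ⇒ log-power saving)
  are statements about our obligations and are kept Summits-side with the route (cell text
  `run/shared/lean/pub/parity-ideate/parity-ideate-lit/wayB/CubeCornerBookkeeping.lean`, which proves
  them from the two identities here);
* `example`s recording that the cell's closed statements (p1's leaf texts K1c, K1c-η, K1c-tw, K1c-log,
  K1⁺, rev 2) are `Iff.rfl`-instances of the shapes.

Provenance: definitions, statements and proofs are the cell text
`run/shared/lean/pub/parity-ideate/parity-ideate-p1/leaves/IllusoryCubeCornerStatements.lean` (rev 2,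
sha256 640425c6…, refereed PASS—KERNEL) re-homed: bodies verbatim, the closed `@[conjecture]` statements
replaced by parametrised shapes, namespace `Literature.NumberTheory.Sieve.NSqAddOneCorner`.

## References
* [Merikoski2022] J. Merikoski, *On the largest prime factor of n² + 1*, J. Eur. Math. Soc. 25 (2023),
  arXiv:1908.08816, §4 (Type-I₂ information; the balanced case).
* [GrimmeltMerikoski2025] L. Grimmelt, J. Merikoski, arXiv:2505.00493 (2025), Theorem 1.4 and §5.
* [DukeFriedlanderIwaniec1995] W. Duke, J. Friedlander, H. Iwaniec, *Equidistribution of roots of a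
  quadratic congruence to prime moduli*, Ann. of Math. 141 (1995) 423–441, p. 425 (the linear forms
  `L_d(M) = Σ_{m∼M} ρ_h(dm)` and the conjectured range of uniformity).
* [FriedlanderIwaniec2005IllusorySieve] J. Friedlander, H. Iwaniec, *The illusory sieve*, IJNT 1 (2005).
* [IwaniecConversations2006] H. Iwaniec, *Conversations on the exceptional character*, in: Analytic
  Number Theory, LNM 1891 (2006), §8 (8.10)–(8.14) (`Λ_∞` treated like `τ₃`).
-/

noncomputable section

namespace Literature.NumberTheory.Sieve.NSqAddOneCorner

open Finset

/-! ## The one-twist dyadic corner count and its model -/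

/-- Localised, congruence-twisted trilinear count: the number of `(ℓ, e, f)` with `1 ≤ ℓ ≤ X`,
`e ∈ (E, 2E]`, `e ≡ a (mod q)`, `f ∈ (F, 2F]`, `e f ∣ ℓ² + 1` and cofactor `g = (ℓ²+1)/(ef) ∈ (G, 2G]`.
[folklore] -/
def cornerCount (X q a : ℕ) (E F G : ℝ) : ℕ :=
  ∑ ℓ ∈ Icc 1 X, ∑ e ∈ (Ioc ⌊E⌋₊ ⌊2 * E⌋₊).filter (fun e => e ≡ a [MOD q]),
    ∑ f ∈ Ioc ⌊F⌋₊ ⌊2 * F⌋₊,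
      if e * f ∣ ℓ ^ 2 + 1 ∧ ⌊G⌋₊ < (ℓ ^ 2 + 1) / (e * f) ∧ (ℓ ^ 2 + 1) / (e * f) ≤ ⌊2 * G⌋₊
      then 1 else 0

/-- Its probabilistic model: local density `ρ(ef)/(ef)` (`ρ = polyRootCountMod ![X²+1]`, the number of
roots of `ν² + 1 ≡ 0`) times the length of `{t ∈ [1, X] : efG < t² + 1 ≤ 2efG}` — the main term of the
linear forms `Σ_m ρ(dm)`-type asymptotics. [cite: DukeFriedlanderIwaniec1995, p. 425 (the linear forms L_d(M) and their expected main term)] -/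
def cornerModel (X q a : ℕ) (E F G : ℝ) : ℝ :=
  ∑ e ∈ (Ioc ⌊E⌋₊ ⌊2 * E⌋₊).filter (fun e => e ≡ a [MOD q]), ∑ f ∈ Ioc ⌊F⌋₊ ⌊2 * F⌋₊,
    (Literature.NumberTheory.Sieve.polyRootCountMod ![(Polynomial.X ^ 2 + 1 : Polynomial ℤ)] (e * f) : ℝ)
      / ((e : ℝ) * f) *
      max 0 (min (X : ℝ) (Real.sqrt (2 * e * f * G - 1)) - max 1 (Real.sqrt (e * f * G - 1)))

/-- Statement SHAPE of the cube-corner problem with one twist (the cell's K1c at `θ = 1/2`, K1c-η at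
`θ = 1/2 − η₁`): for `X ≥ X₀`, `1 ≤ q ≤ X^δ`, all boxes with `E, F, G ≥ X^θ` and
`X²/64 ≤ EFG ≤ X²`, `|cornerCount − cornerModel| ≤ C·X^{1−δ}`. A `Prop`-valued function of
`(θ, δ, C, X₀)`; no instance with `θ ≤ 1/2` is in print (the balanced Type-I₂ case is the problem
Merikoski names). [cite: Merikoski2022, §4 (Type-I₂ information, balanced case)] -/
def CubeCornerBoundWith (θ δ C X₀ : ℝ) : Prop :=
  ∀ X : ℕ, X₀ ≤ X → ∀ q a : ℕ, 1 ≤ q → (q : ℝ) ≤ (X : ℝ) ^ δ →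
    ∀ E F G : ℝ, (X : ℝ) ^ θ ≤ E → (X : ℝ) ^ θ ≤ F → (X : ℝ) ^ θ ≤ G →
      (X : ℝ) ^ 2 / 64 ≤ E * F * G → E * F * G ≤ (X : ℝ) ^ 2 →
        |(cornerCount X q a E F G : ℝ) - cornerModel X q a E F G| ≤ C * (X : ℝ) ^ (1 - δ)

/-! ## All congruence twists, sub-dyadic boxes -/

/-- Local-density numerator of the fully twisted corner count: the number of `ν mod qk` with
`ν ≡ t (mod q)`, `k ∣ ν² + 1` and cofactor class `(ν² + 1)/k ≡ r (mod q)` (a `qk`-periodic condition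
in `ν`). Summed over `t, r mod q` it equals `q·ρ(k)` (`sum_sum_twistedRootCount_eq`). [folklore] -/
def twistedRootCount (q t r k : ℕ) : ℕ :=
  ((Finset.range (q * k)).filter
    (fun ν => ν ≡ t [MOD q] ∧ k ∣ ν ^ 2 + 1 ∧ (ν ^ 2 + 1) / k ≡ r [MOD q])).card

/-- Fully twisted, sub-dyadic corner count: `(ℓ, e, f)` with `1 ≤ ℓ ≤ X`, `ℓ ≡ t`, `e ≡ a`, `f ≡ b`,
cofactor `g = (ℓ²+1)/(ef) ≡ r (mod q)`, `e ∈ (E₁, E₂]`, `f ∈ (F₁, F₂]`, `g ∈ (G₁, G₂]`;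
`cornerCount` is the `(t, b, r)`-summed, dyadic special case (`cornerCount_eq_sum_tw`). [folklore] -/
def cornerCountTw (X q t a b r : ℕ) (E₁ E₂ F₁ F₂ G₁ G₂ : ℝ) : ℕ :=
  ∑ ℓ ∈ (Icc 1 X).filter (fun ℓ => ℓ ≡ t [MOD q]),
    ∑ e ∈ (Ioc ⌊E₁⌋₊ ⌊E₂⌋₊).filter (fun e => e ≡ a [MOD q]),
      ∑ f ∈ (Ioc ⌊F₁⌋₊ ⌊F₂⌋₊).filter (fun f => f ≡ b [MOD q]),
        if e * f ∣ ℓ ^ 2 + 1 ∧ ⌊G₁⌋₊ < (ℓ ^ 2 + 1) / (e * f) ∧ (ℓ ^ 2 + 1) / (e * f) ≤ ⌊G₂⌋₊ ∧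
            (ℓ ^ 2 + 1) / (e * f) ≡ r [MOD q]
        then 1 else 0

/-- Its model: local density `twistedRootCount q t r (ef) / (q·e·f)` times the length of
`{u ∈ [1, X] : efG₁ < u² + 1 ≤ efG₂}`. [folklore] -/
def cornerModelTw (X q t a b r : ℕ) (E₁ E₂ F₁ F₂ G₁ G₂ : ℝ) : ℝ :=
  ∑ e ∈ (Ioc ⌊E₁⌋₊ ⌊E₂⌋₊).filter (fun e => e ≡ a [MOD q]),
    ∑ f ∈ (Ioc ⌊F₁⌋₊ ⌊F₂⌋₊).filter (fun f => f ≡ b [MOD q]),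
      (twistedRootCount q t r (e * f) : ℝ) / ((q : ℝ) * e * f) *
        max 0 (min (X : ℝ) (Real.sqrt (e * f * G₂ - 1)) - max 1 (Real.sqrt (e * f * G₁ - 1)))

/-- Statement SHAPE with ALL congruence twists and sub-dyadic boxes (the cell's K1c-tw at
`θ = 1/2 − η₁`): power saving `C·X^{1−δ}` uniformly for `1 ≤ q ≤ X^δ`, every class `(t, a, b, r)`,
all boxes `(E₁,E₂] × (F₁,F₂] × (G₁,G₂]` with `X^θ ≤ E₁ ≤ E₂ ≤ 2E₁` etc. and `X²/64 ≤ E₁F₁G₁ ≤ X²`.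
No instance with `θ ≤ 1/2` is in print. [cite: Merikoski2022, §4 (Type-I₂ information, balanced case)] -/
def CubeCornerTwBoundWith (θ δ C X₀ : ℝ) : Prop :=
  ∀ X : ℕ, X₀ ≤ X → ∀ q t a b r : ℕ, 1 ≤ q →
    (q : ℝ) ≤ (X : ℝ) ^ δ → ∀ E₁ E₂ F₁ F₂ G₁ G₂ : ℝ,
      (X : ℝ) ^ θ ≤ E₁ → E₁ ≤ E₂ → E₂ ≤ 2 * E₁ →
      (X : ℝ) ^ θ ≤ F₁ → F₁ ≤ F₂ → F₂ ≤ 2 * F₁ →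
      (X : ℝ) ^ θ ≤ G₁ → G₁ ≤ G₂ → G₂ ≤ 2 * G₁ →
      (X : ℝ) ^ 2 / 64 ≤ E₁ * F₁ * G₁ → E₁ * F₁ * G₁ ≤ (X : ℝ) ^ 2 →
        |(cornerCountTw X q t a b r E₁ E₂ F₁ F₂ G₁ G₂ : ℝ) - cornerModelTw X q t a b r E₁ E₂ F₁ F₂ G₁ G₂|
          ≤ C * (X : ℝ) ^ (1 - δ)

/-- Statement SHAPE: as `CubeCornerTwBoundWith` (all congruence twists, sub-dyadic boxes, thresholds `X^θ`,
`1 ≤ q ≤ X^δ`) with the error term `C·X·(log X)^{−A}` in place of `C·X^{1−δ}` (the cell's K1c-log at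
`θ = 1/2 − η₁`, parameters `(θ, δ, A, C, X₀)`). No instance with `θ ≤ 1/2` is in print.
[cite: Merikoski2022, §4 (Type-I₂ information, balanced case)] -/
def CubeCornerTwLogBoundWith (θ δ A C X₀ : ℝ) : Prop :=
  ∀ X : ℕ, X₀ ≤ X → ∀ q t a b r : ℕ, 1 ≤ q →
    (q : ℝ) ≤ (X : ℝ) ^ δ → ∀ E₁ E₂ F₁ F₂ G₁ G₂ : ℝ,
      (X : ℝ) ^ θ ≤ E₁ → E₁ ≤ E₂ → E₂ ≤ 2 * E₁ →
      (X : ℝ) ^ θ ≤ F₁ → F₁ ≤ F₂ → F₂ ≤ 2 * F₁ →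
      (X : ℝ) ^ θ ≤ G₁ → G₁ ≤ G₂ → G₂ ≤ 2 * G₁ →
      (X : ℝ) ^ 2 / 64 ≤ E₁ * F₁ * G₁ → E₁ * F₁ * G₁ ≤ (X : ℝ) ^ 2 →
        |(cornerCountTw X q t a b r E₁ E₂ F₁ F₂ G₁ G₂ : ℝ) - cornerModelTw X q t a b r E₁ E₂ F₁ F₂ G₁ G₂|
          ≤ C * (X : ℝ) * Real.log (X : ℝ) ^ (-A)

/-! ### Sanity values of `twistedRootCount` (kernel-evaluated) -/

/-- `q = 1`: `twistedRootCount 1 0 0 5 = ρ(5) = 2` (roots `2, 3` of `ν² + 1 ≡ 0 (mod 5)`). -/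
example : twistedRootCount 1 0 0 5 = 2 := by decide
/-- `q = 2`, `k = 5`: the roots `ν mod 10` with `ν` odd and `(ν²+1)/5` even are `3, 7`. -/
example : twistedRootCount 2 1 0 5 = 2 := by decide
/-- `q = 2`, `k = 5`: no odd `ν` has `(ν²+1)/5` odd (`ν² + 1 ≡ 2 (mod 4)` forces `(ν²+1)/5` even). -/
example : twistedRootCount 2 1 1 5 = 0 := by decide
/-- `q = 2`, `k = 5`: even `ν` (`ν = 2, 8 mod 10`) has `(ν²+1)/5` odd. -/
example : twistedRootCount 2 0 1 5 = 2 := by decide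

/-! ## All twists ⟹ one twist: exact re-indexing (count side) -/

/-- Exactly one `r < q` is `≡ g (mod q)` (private helper). [folklore] -/
private lemma sum_range_ite_modEq {M : Type*} [AddCommMonoid M] (q : ℕ) (hq : 0 < q) (g : ℕ) (x : M) :
    ∑ r ∈ range q, (if g ≡ r [MOD q] then x else 0) = x := by
  have h : ∀ r ∈ range q, (if g ≡ r [MOD q] then x else 0) = (if g % q = r then x else 0) := by
    intro r hr
    have : (g ≡ r [MOD q]) ↔ g % q = r := by
      rw [Nat.ModEq, Nat.mod_eq_of_lt (mem_range.1 hr)]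
    simp only [this]
  rw [sum_congr rfl h, sum_ite_eq]
  simp [mem_range.2 (Nat.mod_lt g hq)]

/-- Summing over the classes `b < q` of a sum filtered by `≡ b` recovers the unfiltered sum (private
helper). [folklore] -/
private lemma sum_range_sum_filter_modEq {M : Type*} [AddCommMonoid M] (q : ℕ) (hq : 0 < q) (s : Finset ℕ)
    (h : ℕ → M) :
    ∑ b ∈ range q, ∑ f ∈ s.filter (fun f => f ≡ b [MOD q]), h f = ∑ f ∈ s, h f := by
  simp_rw [Finset.sum_filter]
  rw [Finset.sum_comm]
  exact sum_congr rfl (fun f _ => sum_range_ite_modEq q hq f (h f))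

/-- Abstract re-indexing behind `cornerCount = Σ_{t,b,r} cornerCountTw` (private helper). [folklore] -/
private lemma count_reindex (q : ℕ) (hq : 0 < q) (sℓ se sf : Finset ℕ) (P₁ P₂ P₃ : ℕ → ℕ → ℕ → Prop)
    [∀ ℓ e f, Decidable (P₁ ℓ e f)] [∀ ℓ e f, Decidable (P₂ ℓ e f)] [∀ ℓ e f, Decidable (P₃ ℓ e f)]
    (g : ℕ → ℕ → ℕ → ℕ) :
    ∑ t ∈ range q, ∑ b ∈ range q, ∑ r ∈ range q,
      ∑ ℓ ∈ sℓ.filter (fun ℓ => ℓ ≡ t [MOD q]), ∑ e ∈ se, ∑ f ∈ sf.filter (fun f => f ≡ b [MOD q]),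
        (if P₁ ℓ e f ∧ P₂ ℓ e f ∧ P₃ ℓ e f ∧ g ℓ e f ≡ r [MOD q] then 1 else 0 : ℕ)
    = ∑ ℓ ∈ sℓ, ∑ e ∈ se, ∑ f ∈ sf, (if P₁ ℓ e f ∧ P₂ ℓ e f ∧ P₃ ℓ e f then 1 else 0 : ℕ) := by
  -- step 1: the `r`-sum removes the last congruence condition
  have step1 : ∀ t b, ∑ r ∈ range q,
      ∑ ℓ ∈ sℓ.filter (fun ℓ => ℓ ≡ t [MOD q]), ∑ e ∈ se, ∑ f ∈ sf.filter (fun f => f ≡ b [MOD q]),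
        (if P₁ ℓ e f ∧ P₂ ℓ e f ∧ P₃ ℓ e f ∧ g ℓ e f ≡ r [MOD q] then 1 else 0 : ℕ)
      = ∑ ℓ ∈ sℓ.filter (fun ℓ => ℓ ≡ t [MOD q]), ∑ e ∈ se, ∑ f ∈ sf.filter (fun f => f ≡ b [MOD q]),
        (if P₁ ℓ e f ∧ P₂ ℓ e f ∧ P₃ ℓ e f then 1 else 0 : ℕ) := by
    intro t b
    rw [Finset.sum_comm]
    refine sum_congr rfl (fun ℓ _ => ?_)
    rw [Finset.sum_comm]
    refine sum_congr rfl (fun e _ => ?_)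
    rw [Finset.sum_comm]
    refine sum_congr rfl (fun f _ => ?_)
    by_cases hP : (P₁ ℓ e f ∧ P₂ ℓ e f ∧ P₃ ℓ e f)
    · rw [if_pos hP]
      have hiff : ∀ r, ((P₁ ℓ e f ∧ P₂ ℓ e f ∧ P₃ ℓ e f ∧ g ℓ e f ≡ r [MOD q]) ↔ (g ℓ e f ≡ r [MOD q])) :=
        fun r => ⟨fun h => h.2.2.2, fun h => ⟨hP.1, hP.2.1, hP.2.2, h⟩⟩
      simp only [hiff]
      exact sum_range_ite_modEq q hq _ 1
    · rw [if_neg hP]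
      refine Finset.sum_eq_zero (fun r _ => ?_)
      rw [if_neg]
      rintro ⟨h1, h2, h3, -⟩
      exact hP ⟨h1, h2, h3⟩
  simp_rw [step1]
  -- step 2: the `b`-sum removes the filter on `f`
  have step2 : ∀ t, ∑ b ∈ range q,
      ∑ ℓ ∈ sℓ.filter (fun ℓ => ℓ ≡ t [MOD q]), ∑ e ∈ se, ∑ f ∈ sf.filter (fun f => f ≡ b [MOD q]),
        (if P₁ ℓ e f ∧ P₂ ℓ e f ∧ P₃ ℓ e f then 1 else 0 : ℕ)
      = ∑ ℓ ∈ sℓ.filter (fun ℓ => ℓ ≡ t [MOD q]), ∑ e ∈ se, ∑ f ∈ sf,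
        (if P₁ ℓ e f ∧ P₂ ℓ e f ∧ P₃ ℓ e f then 1 else 0 : ℕ) := by
    intro t
    rw [Finset.sum_comm]
    refine sum_congr rfl (fun ℓ _ => ?_)
    rw [Finset.sum_comm]
    refine sum_congr rfl (fun e _ => ?_)
    exact sum_range_sum_filter_modEq q hq sf _
  simp_rw [step2]
  -- step 3: the `t`-sum removes the filter on `ℓ`
  exact sum_range_sum_filter_modEq q hq sℓ _

/-- `cornerCount` is the sum of `cornerCountTw` over the `q³` classes `(t, b, r) mod q` at dyadic boxes
(definitional identity for the counting function: partition of `ℓ`, `f` and the cofactor into residue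
classes). [cite: DukeFriedlanderIwaniec1995, p. 425 (the counts of roots over multiples of d that these objects localise; identity is definitional)] -/
theorem cornerCount_eq_sum_tw (X q a : ℕ) (hq : 0 < q) (E F G : ℝ) :
    cornerCount X q a E F G =
      ∑ t ∈ range q, ∑ b ∈ range q, ∑ r ∈ range q,
        cornerCountTw X q t a b r E (2 * E) F (2 * F) G (2 * G) := by
  unfold cornerCount cornerCountTw
  exact (count_reindex q hq (Icc 1 X) ((Ioc ⌊E⌋₊ ⌊2 * E⌋₊).filter (fun e => e ≡ a [MOD q]))
    (Ioc ⌊F⌋₊ ⌊2 * F⌋₊) (fun ℓ e f => e * f ∣ ℓ ^ 2 + 1) (fun ℓ e f => ⌊G⌋₊ < (ℓ ^ 2 + 1) / (e * f))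
    (fun ℓ e f => (ℓ ^ 2 + 1) / (e * f) ≤ ⌊2 * G⌋₊) (fun ℓ e f => (ℓ ^ 2 + 1) / (e * f))).symm

/-! ### model side -/

/-- Summing the twisted root count over both classes `t, r (mod q)` forgets the twists: the result is
the number of roots of `ν² + 1 ≡ 0 (mod k)` below `qk`. [cite: DukeFriedlanderIwaniec1995, p. 425 (ρ(d) = the number of roots of the quadratic congruence mod d)] -/
lemma sum_sum_twistedRootCount (q k : ℕ) (hq : 0 < q) :
    ∑ t ∈ range q, ∑ r ∈ range q, twistedRootCount q t r k
      = #((range (q * k)).filter (fun ν => k ∣ ν ^ 2 + 1)) := by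
  unfold twistedRootCount
  simp_rw [Finset.card_filter]
  rw [Finset.sum_comm]
  refine (sum_congr rfl (fun t _ => Finset.sum_comm)).trans ?_
  rw [Finset.sum_comm]
  refine sum_congr rfl (fun ν _ => ?_)
  by_cases hB : k ∣ ν ^ 2 + 1
  · rw [if_pos hB]
    have hsplit : ∀ t r, (if ν ≡ t [MOD q] ∧ k ∣ ν ^ 2 + 1 ∧ (ν ^ 2 + 1) / k ≡ r [MOD q] then 1 else 0 : ℕ)
        = (if ν ≡ t [MOD q] then 1 else 0) * (if (ν ^ 2 + 1) / k ≡ r [MOD q] then 1 else 0) := by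
      intro t r
      by_cases h1 : ν ≡ t [MOD q] <;> by_cases h2 : (ν ^ 2 + 1) / k ≡ r [MOD q] <;> simp [h1, h2, hB]
    simp_rw [hsplit, ← Finset.sum_mul, sum_range_ite_modEq q hq ν (1 : ℕ), one_mul]
    exact sum_range_ite_modEq q hq _ (1 : ℕ)
  · rw [if_neg hB]
    refine Finset.sum_eq_zero (fun t _ => Finset.sum_eq_zero (fun r _ => ?_))
    rw [if_neg]
    rintro ⟨-, h, -⟩
    exact hB h

/-- Periodicity: the roots of `ν² + 1 ≡ 0 (mod k)` below `q·k` are `q` copies of those below `k`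
(`ρ` is a function of the residue class). [cite: DukeFriedlanderIwaniec1995, p. 425 (ρ(d) = the number of roots of the quadratic congruence mod d)] -/
lemma card_filter_range_mul (q k : ℕ) :
    #((range (q * k)).filter (fun ν => k ∣ ν ^ 2 + 1)) = q * #((range k).filter (fun ν => k ∣ ν ^ 2 + 1)) := by
  induction q with
  | zero => simp
  | succ q ih =>
    rw [Nat.succ_mul, Finset.range_add_eq_union, Finset.filter_union,
      Finset.card_union_of_disjoint
        ((Finset.disjoint_range_addLeftEmbedding _ _).mono (filter_subset _ _) (filter_subset _ _)),
      ih, Finset.filter_map, Finset.card_map, Nat.succ_mul]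
    congr 2
    ext ν
    simp only [mem_filter, Function.comp, addLeftEmbedding_apply]
    have hper : k ∣ (q * k + ν) ^ 2 + 1 ↔ k ∣ ν ^ 2 + 1 := by
      have : (q * k + ν) ^ 2 + 1 = k * (q * q * k + 2 * q * ν) + (ν ^ 2 + 1) := by ring
      rw [this, Nat.dvd_add_right (dvd_mul_right k _)]
    rw [hper]

/-- `ρ(k) = #{ν < k : k ∣ ν² + 1}` for the family `![X² + 1]` (unfolding of the tree's
`polyRootCountMod`). [cite: DukeFriedlanderIwaniec1995, p. 425 (ρ(d) = the number of roots of the quadratic congruence mod d)] -/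
lemma polyRootCountMod_sq_add_one (k : ℕ) :
    Literature.NumberTheory.Sieve.polyRootCountMod ![(Polynomial.X ^ 2 + 1 : Polynomial ℤ)] k
      = #((range k).filter (fun ν => k ∣ ν ^ 2 + 1)) := by
  unfold Literature.NumberTheory.Sieve.polyRootCountMod
  congr 1
  refine filter_congr (fun ν _ => ?_)
  simp only [Fin.prod_univ_one, Matrix.cons_val_fin_one, Polynomial.eval_add, Polynomial.eval_pow,
    Polynomial.eval_X, Polynomial.eval_one]
  exact_mod_cast Int.natCast_dvd_natCast

/-- `∑_{t,r mod q} twistedRootCount q t r k = q·ρ(k)`. [cite: DukeFriedlanderIwaniec1995, p. 425 (ρ(d) = the number of roots of the quadratic congruence mod d)] -/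
lemma sum_sum_twistedRootCount_eq (q k : ℕ) (hq : 0 < q) :
    ∑ t ∈ range q, ∑ r ∈ range q, twistedRootCount q t r k
      = q * Literature.NumberTheory.Sieve.polyRootCountMod ![(Polynomial.X ^ 2 + 1 : Polynomial ℤ)] k := by
  rw [sum_sum_twistedRootCount q k hq, card_filter_range_mul, polyRootCountMod_sq_add_one]

/-- Abstract re-indexing behind `cornerModel = Σ_{t,b,r} cornerModelTw` (private helper). [folklore] -/
private lemma model_reindex (q : ℕ) (hq : 0 < q) (se sf : Finset ℕ) (N : ℕ → ℕ → ℕ → ℕ → ℕ) (L : ℕ → ℕ → ℝ) :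
    ∑ t ∈ range q, ∑ b ∈ range q, ∑ r ∈ range q, ∑ e ∈ se, ∑ f ∈ sf.filter (fun f => f ≡ b [MOD q]),
        (N t r e f : ℝ) / ((q : ℝ) * e * f) * L e f
      = ∑ e ∈ se, ∑ f ∈ sf,
        ((∑ t ∈ range q, ∑ r ∈ range q, N t r e f : ℕ) : ℝ) / ((q : ℝ) * e * f) * L e f := by
  have h1 : ∀ b, ∑ t ∈ range q, ∑ r ∈ range q, ∑ e ∈ se, ∑ f ∈ sf.filter (fun f => f ≡ b [MOD q]),
        (N t r e f : ℝ) / ((q : ℝ) * e * f) * L e f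
      = ∑ e ∈ se, ∑ f ∈ sf.filter (fun f => f ≡ b [MOD q]),
        ((∑ t ∈ range q, ∑ r ∈ range q, N t r e f : ℕ) : ℝ) / ((q : ℝ) * e * f) * L e f := by
    intro b
    -- Σ_t Σ_r Σ_e Σ_f  →  Σ_e Σ_f Σ_t Σ_r
    refine (sum_congr rfl (fun t _ => Finset.sum_comm)).trans ?_
    rw [Finset.sum_comm]
    refine sum_congr rfl (fun e _ => ?_)
    refine (sum_congr rfl (fun t _ => Finset.sum_comm)).trans ?_
    rw [Finset.sum_comm]
    refine sum_congr rfl (fun f _ => ?_)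
    simp only [Nat.cast_sum, Finset.sum_div, Finset.sum_mul]
  rw [Finset.sum_comm]
  simp_rw [h1]
  rw [Finset.sum_comm]
  exact sum_congr rfl (fun e _ => sum_range_sum_filter_modEq q hq sf _)

/-- `cornerModel` is the sum of `cornerModelTw` over the `q³` classes `(t, b, r) mod q` at dyadic boxes
(definitional identity for the model, through `sum_sum_twistedRootCount_eq`). [cite: DukeFriedlanderIwaniec1995, p. 425 (main term ρ(d)/d × length of the linear forms these models localise; identity is definitional)] -/
theorem cornerModel_eq_sum_tw (X q a : ℕ) (hq : 0 < q) (E F G : ℝ) :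
    cornerModel X q a E F G =
      ∑ t ∈ range q, ∑ b ∈ range q, ∑ r ∈ range q,
        cornerModelTw X q t a b r E (2 * E) F (2 * F) G (2 * G) := by
  unfold cornerModel cornerModelTw
  rw [model_reindex q hq _ _ (fun t r e f => twistedRootCount q t r (e * f))]
  refine sum_congr rfl (fun e _ => sum_congr rfl (fun f _ => ?_))
  have hG : (e : ℝ) * f * (2 * G) = 2 * e * f * G := by ring
  rw [hG, sum_sum_twistedRootCount_eq q (e * f) hq, Nat.cast_mul,
    show ((q : ℝ) * e * f) = q * ((e : ℝ) * f) by ring,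
    mul_div_mul_left _ _ (by exact_mod_cast hq.ne' : (q : ℝ) ≠ 0)]

/-! ## Grimmelt–Merikoski's Type-I form with the modulus in a residue class -/

/-- GM25's Type-I form `GM2025.typeISum 1 1` (roots of `ℓ² + 1`) with the smooth modulus `k`
additionally restricted to a residue class `k ≡ k₀ (mod D₀)`:
`∑_{d ≤ D} ‖∑_{k ≡ 0 (d), k ≡ k₀ (D₀)} ψ₁(k/K) · disc(k; ψ₂, X)‖`. At `D₀ = 1` it is `typeISum 1 1`
(`typeISumAP_modulus_one`). [cite: GrimmeltMerikoski2025, Theorem 1.4 (the sum bounded there, at D₀ = 1)] -/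
def typeISumAP (k₀ D₀ : ℕ) (ψ₁ ψ₂ : ℝ → ℂ) (X K D : ℝ) : ℝ :=
  ∑ d ∈ Icc 1 ⌊D⌋₊,
    ‖∑ k ∈ (Icc 1 ⌊2 * K⌋₊).filter (fun k : ℕ => d ∣ k ∧ k ≡ k₀ [MOD D₀]),
      ψ₁ ((k : ℝ) / K) * Literature.NumberTheory.Sieve.GM2025.rootDiscrepancy 1 1 k ψ₂ X‖

/-- At `D₀ = 1` the residue condition is void: `typeISumAP k₀ 1 = GM2025.typeISum 1 1`.
[cite: GrimmeltMerikoski2025, Theorem 1.4] -/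
theorem typeISumAP_modulus_one (k₀ : ℕ) (ψ₁ ψ₂ : ℝ → ℂ) (X K D : ℝ) :
    typeISumAP k₀ 1 ψ₁ ψ₂ X K D = Literature.NumberTheory.Sieve.GM2025.typeISum 1 1 ψ₁ ψ₂ X K D := by
  unfold typeISumAP Literature.NumberTheory.Sieve.GM2025.typeISum
  simp only [Nat.modEq_one, and_true]

/-- Statement SHAPE (the cell's K1⁺ with `(ε, δ, J, X₀)` as parameters): the conclusion of
`grimmeltMerikoski2025_thm14_restricted_one` (GM25 Theorem 1.4 for `ℓ² + 1` in the range
`K ≤ D·X^{1+δ}` its proof treats) with the modulus restricted to `k ≡ k₀ (mod D₀)`, uniformly for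
`1 ≤ D₀ ≤ X^δ`, same bound `X^ε · D X^{1/2} (1 + X/D²)^{7/64}`. Printed (and in the tree) only at
`D₀ = 1` (`gm25TypeIResidueClassesWith_one`). [cite: GrimmeltMerikoski2025, Theorem 1.4 and §5 (first paragraph)] -/
def GM25TypeIResidueClassesWith (ε δ : ℝ) (J : ℕ) (X₀ : ℝ) : Prop :=
  ∀ X : ℝ, X₀ ≤ X →
    ∀ D K : ℝ, 1 ≤ D → D ≤ K → K ≤ X ^ 2 → K ≤ D * X ^ (1 + δ) → D ≤ X ^ (1 / 2 : ℝ) →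
    ∀ D₀ k₀ : ℕ, 1 ≤ D₀ → (D₀ : ℝ) ≤ X ^ δ →
    ∀ ψ₁ ψ₂ : ℝ → ℂ, Literature.NumberTheory.Sieve.GM2025.IsAdmissibleWeight ψ₁ 1 2 J (X ^ δ) →
      Literature.NumberTheory.Sieve.GM2025.IsAdmissibleWeight ψ₂ (-1) 1 J (X ^ δ) →
      typeISumAP k₀ D₀ ψ₁ ψ₂ X K D ≤
        X ^ ε * (D * X ^ (1 / 2 : ℝ) * (1 + X / D ^ 2) ^ (7 / 64 : ℝ))

/-- **The `D₀ = 1` case is Grimmelt–Merikoski's Theorem 1.4** (restricted range, `ℓ² + 1`), i.e. the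
tree's `grimmeltMerikoski2025_thm14_restricted_one` — conditional on that named fact exactly as its
source corollary is. [cite: GrimmeltMerikoski2025, Theorem 1.4 and §5 (first paragraph)] -/
theorem gm25TypeIResidueClassesWith_one
    (hGM : Literature.NumberTheory.Sieve.grimmeltMerikoski2025_thm14_restricted) :
    ∀ ε : ℝ, 0 < ε → ∃ δ : ℝ, 0 < δ ∧ ∃ J : ℕ, ∃ X₀ : ℝ, ∀ X : ℝ, X₀ ≤ X →
      ∀ D K : ℝ, 1 ≤ D → D ≤ K → K ≤ X ^ 2 → K ≤ D * X ^ (1 + δ) → D ≤ X ^ (1 / 2 : ℝ) →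
      ∀ k₀ : ℕ, ∀ ψ₁ ψ₂ : ℝ → ℂ,
        Literature.NumberTheory.Sieve.GM2025.IsAdmissibleWeight ψ₁ 1 2 J (X ^ δ) →
        Literature.NumberTheory.Sieve.GM2025.IsAdmissibleWeight ψ₂ (-1) 1 J (X ^ δ) →
        typeISumAP k₀ 1 ψ₁ ψ₂ X K D ≤ X ^ ε * (D * X ^ (1 / 2 : ℝ) * (1 + X / D ^ 2) ^ (7 / 64 : ℝ)) := by
  intro ε hε
  obtain ⟨δ, hδ, J, X₀, h⟩ :=
    Literature.NumberTheory.Sieve.grimmeltMerikoski2025_thm14_restricted_one hGM ε hε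
  refine ⟨δ, hδ, J, X₀, fun X hX D K h₁ h₂ h₃ h₄ h₅ k₀ ψ₁ ψ₂ hψ₁ hψ₂ => ?_⟩
  rw [typeISumAP_modulus_one]
  exact h X hX D K h₁ h₂ h₃ h₄ h₅ ψ₁ ψ₂ hψ₁ hψ₂

/-- Conversely the residue-class shape specialises to `D₀ = 1` (for `X ≥ 1`, so that `1 ≤ X^δ`).
[cite: GrimmeltMerikoski2025, Theorem 1.4] -/
theorem GM25TypeIResidueClassesWith.modulus_one {ε δ : ℝ} {J : ℕ} {X₀ : ℝ} (hδ : 0 ≤ δ)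
    (h : GM25TypeIResidueClassesWith ε δ J X₀) :
    ∀ X : ℝ, max X₀ 1 ≤ X →
      ∀ D K : ℝ, 1 ≤ D → D ≤ K → K ≤ X ^ 2 → K ≤ D * X ^ (1 + δ) → D ≤ X ^ (1 / 2 : ℝ) →
      ∀ k₀ : ℕ, ∀ ψ₁ ψ₂ : ℝ → ℂ,
        Literature.NumberTheory.Sieve.GM2025.IsAdmissibleWeight ψ₁ 1 2 J (X ^ δ) →
        Literature.NumberTheory.Sieve.GM2025.IsAdmissibleWeight ψ₂ (-1) 1 J (X ^ δ) →
        typeISumAP k₀ 1 ψ₁ ψ₂ X K D ≤ X ^ ε * (D * X ^ (1 / 2 : ℝ) * (1 + X / D ^ 2) ^ (7 / 64 : ℝ)) := by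
  intro X hX D K h₁ h₂ h₃ h₄ h₅ k₀ ψ₁ ψ₂ hψ₁ hψ₂
  have hX₀ : X₀ ≤ X := (le_max_left _ _).trans hX
  have hX1 : (1 : ℝ) ≤ X := (le_max_right _ _).trans hX
  have hD₀ : ((1 : ℕ) : ℝ) ≤ X ^ δ := by
    rw [Nat.cast_one]
    exact Real.one_le_rpow hX1 hδ
  exact h X hX₀ D K h₁ h₂ h₃ h₄ h₅ 1 k₀ le_rfl hD₀ ψ₁ ψ₂ hψ₁ hψ₂

/-! ## The cell's closed statements are instances of the shapes (definitional unfoldings)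

Recorded for the route `IllusoryCubeCorner` and its referee: each `example` states that the closed
statement on the right (the cell's leaf text, rev 2, token for token) is by `Iff.rfl` the displayed
instance of the parametrised shape. -/

/-- K1c (thresholds `X^{1/2}`, one twist). -/
example : (∃ δ : ℝ, 0 < δ ∧ ∃ C X₀ : ℝ, CubeCornerBoundWith (1 / 2 : ℝ) δ C X₀) ↔
    ∃ δ : ℝ, 0 < δ ∧ ∃ C X₀ : ℝ, ∀ X : ℕ, X₀ ≤ X → ∀ q a : ℕ, 1 ≤ q → (q : ℝ) ≤ (X : ℝ) ^ δ →
      ∀ E F G : ℝ, (X : ℝ) ^ (1 / 2 : ℝ) ≤ E → (X : ℝ) ^ (1 / 2 : ℝ) ≤ F → (X : ℝ) ^ (1 / 2 : ℝ) ≤ G →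
        (X : ℝ) ^ 2 / 64 ≤ E * F * G → E * F * G ≤ (X : ℝ) ^ 2 →
          |(cornerCount X q a E F G : ℝ) - cornerModel X q a E F G| ≤ C * (X : ℝ) ^ (1 - δ) :=
  Iff.rfl

/-- K1c-η (thresholds `X^{1/2−η₁}` for some `η₁ > 0`, one twist). -/
example : (∃ η₁ : ℝ, 0 < η₁ ∧ ∃ δ : ℝ, 0 < δ ∧ ∃ C X₀ : ℝ, CubeCornerBoundWith (1 / 2 - η₁) δ C X₀) ↔
    ∃ η₁ : ℝ, 0 < η₁ ∧ ∃ δ : ℝ, 0 < δ ∧ ∃ C X₀ : ℝ, ∀ X : ℕ, X₀ ≤ X → ∀ q a : ℕ, 1 ≤ q →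
      (q : ℝ) ≤ (X : ℝ) ^ δ →
      ∀ E F G : ℝ, (X : ℝ) ^ (1 / 2 - η₁) ≤ E → (X : ℝ) ^ (1 / 2 - η₁) ≤ F → (X : ℝ) ^ (1 / 2 - η₁) ≤ G →
        (X : ℝ) ^ 2 / 64 ≤ E * F * G → E * F * G ≤ (X : ℝ) ^ 2 →
          |(cornerCount X q a E F G : ℝ) - cornerModel X q a E F G| ≤ C * (X : ℝ) ^ (1 - δ) :=
  Iff.rfl

/-- K1c-tw (all twists, sub-dyadic boxes, thresholds `X^{1/2−η₁}` for some `η₁ > 0`). -/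
example : (∃ η₁ : ℝ, 0 < η₁ ∧ ∃ δ : ℝ, 0 < δ ∧ ∃ C X₀ : ℝ, CubeCornerTwBoundWith (1 / 2 - η₁) δ C X₀) ↔
    ∃ η₁ : ℝ, 0 < η₁ ∧ ∃ δ : ℝ, 0 < δ ∧ ∃ C X₀ : ℝ, ∀ X : ℕ, X₀ ≤ X → ∀ q t a b r : ℕ, 1 ≤ q →
      (q : ℝ) ≤ (X : ℝ) ^ δ → ∀ E₁ E₂ F₁ F₂ G₁ G₂ : ℝ,
        (X : ℝ) ^ (1 / 2 - η₁) ≤ E₁ → E₁ ≤ E₂ → E₂ ≤ 2 * E₁ →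
        (X : ℝ) ^ (1 / 2 - η₁) ≤ F₁ → F₁ ≤ F₂ → F₂ ≤ 2 * F₁ →
        (X : ℝ) ^ (1 / 2 - η₁) ≤ G₁ → G₁ ≤ G₂ → G₂ ≤ 2 * G₁ →
        (X : ℝ) ^ 2 / 64 ≤ E₁ * F₁ * G₁ → E₁ * F₁ * G₁ ≤ (X : ℝ) ^ 2 →
          |(cornerCountTw X q t a b r E₁ E₂ F₁ F₂ G₁ G₂ : ℝ) - cornerModelTw X q t a b r E₁ E₂ F₁ F₂ G₁ G₂|
            ≤ C * (X : ℝ) ^ (1 - δ) :=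
  Iff.rfl

/-- K1c-log (all twists, log-power saving for every `A`). -/
example : (∃ η₁ : ℝ, 0 < η₁ ∧ ∃ δ : ℝ, 0 < δ ∧ ∀ A : ℝ, ∃ C X₀ : ℝ,
      CubeCornerTwLogBoundWith (1 / 2 - η₁) δ A C X₀) ↔
    ∃ η₁ : ℝ, 0 < η₁ ∧ ∃ δ : ℝ, 0 < δ ∧ ∀ A : ℝ, ∃ C X₀ : ℝ, ∀ X : ℕ, X₀ ≤ X → ∀ q t a b r : ℕ, 1 ≤ q →
      (q : ℝ) ≤ (X : ℝ) ^ δ → ∀ E₁ E₂ F₁ F₂ G₁ G₂ : ℝ,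
        (X : ℝ) ^ (1 / 2 - η₁) ≤ E₁ → E₁ ≤ E₂ → E₂ ≤ 2 * E₁ →
        (X : ℝ) ^ (1 / 2 - η₁) ≤ F₁ → F₁ ≤ F₂ → F₂ ≤ 2 * F₁ →
        (X : ℝ) ^ (1 / 2 - η₁) ≤ G₁ → G₁ ≤ G₂ → G₂ ≤ 2 * G₁ →
        (X : ℝ) ^ 2 / 64 ≤ E₁ * F₁ * G₁ → E₁ * F₁ * G₁ ≤ (X : ℝ) ^ 2 →
          |(cornerCountTw X q t a b r E₁ E₂ F₁ F₂ G₁ G₂ : ℝ) - cornerModelTw X q t a b r E₁ E₂ F₁ F₂ G₁ G₂|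
            ≤ C * (X : ℝ) * Real.log (X : ℝ) ^ (-A) :=
  Iff.rfl

/-- K1⁺ (GM25 Theorem 1.4, restricted range, with the modulus in a residue class mod `D₀ ≤ X^δ`). -/
example : (∀ ε : ℝ, 0 < ε → ∃ δ : ℝ, 0 < δ ∧ ∃ J : ℕ, ∃ X₀ : ℝ, GM25TypeIResidueClassesWith ε δ J X₀) ↔
    ∀ ε : ℝ, 0 < ε → ∃ δ : ℝ, 0 < δ ∧ ∃ J : ℕ, ∃ X₀ : ℝ, ∀ X : ℝ, X₀ ≤ X →
      ∀ D K : ℝ, 1 ≤ D → D ≤ K → K ≤ X ^ 2 → K ≤ D * X ^ (1 + δ) → D ≤ X ^ (1 / 2 : ℝ) →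
      ∀ D₀ k₀ : ℕ, 1 ≤ D₀ → (D₀ : ℝ) ≤ X ^ δ →
      ∀ ψ₁ ψ₂ : ℝ → ℂ, Literature.NumberTheory.Sieve.GM2025.IsAdmissibleWeight ψ₁ 1 2 J (X ^ δ) →
        Literature.NumberTheory.Sieve.GM2025.IsAdmissibleWeight ψ₂ (-1) 1 J (X ^ δ) →
        typeISumAP k₀ D₀ ψ₁ ψ₂ X K D ≤
          X ^ ε * (D * X ^ (1 / 2 : ℝ) * (1 + X / D ^ 2) ^ (7 / 64 : ℝ)) :=
  Iff.rfl

end Literature.NumberTheory.Sieve.NSqAddOneCorner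

end
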